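import Summits.Ventures.CertifiedManyBodySolver.Observables.StiffnessApexTransportBandBoxes
import HarnessLib

/-!
# Ventures/CertifiedManyBodySolver — Observables/StiffnessApexTransportTwoStationBoxes.lean

HONEST FRAMING: one-sided certified CEILINGS on the uniform flux stiffness (t–t′ f-sum class) at ANY density, on WHOLE BOXES `[U_a, U_b] × [t′₁, t′₂]` bracketed by the apex
hoppings of TWO solved sources at TWO stations `U₁ ≤ U₂ < U_a` — AREA words — every word CONDITIONAL on the two source rows / row families it names; a ceiling never speaks to the
presence of order; not a `T_c` estimate, not a superconductivity verdict; no number of record. Zero compute, no definition, no claim node, no `sorry`.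

Cell `pub/hubbard-fast` (D-0154 (1)(A) «CERTIFICATE REUSE along parameter paths»), seat `hubbard-fast-reuse-2` g6 (`prover-hubbard-fast-reuse-2-g6-0`), path family «APEX TRANSPORT»,
line «U-AFFINE BOXES», object «TWO-STATION BOXES» — the general form of the companion `Observables/StiffnessApexTransportBandBoxes.lean` (same seat, same session; there `U₁ = U₂`).

THE POINT. Members `i = 1, 2` at stations `U_i` (`0 ≤ U₁`, `0 ≤ U₂`, both `< U`), slots `s_i`, affine hopping floors `α_i + β_iκ` on hopping ranges; `d_i = U − U_i`, `K_i = Us_i − U_it`,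
apex hoppings `κ_i = K_i/d_i`. With `E := K₂d₁ − K₁d₂` (`= d₁d₂(κ₂ − κ₁) > 0` on a bracket `κ₁ ≤ 2t ≤ κ₂`, `κ₁ < κ₂`) the g3 weighted bracket has `μ₁ = (K₂ − 2td₂)d₁/E`,
`μ₂ = (2td₁ − K₁)d₂/E`, and the word inequality × `4E` reads

  `P(U,t) := 4cE + (K₂ − 2td₂)(α₁d₁ + β₁K₁) + (2td₁ − K₁)(α₂d₂ + β₂K₂) ≥ 0` — every term a product of TWO `U`-affine factors,

so `P(·,t)` is a QUADRATIC in `U` with the `t`-affine leading coefficient `q(t) = 4c(s₂ − s₁) + (s₂ − 2t)(α₁ + β₁s₁) + (2t − s₁)(α₂ + β₂s₂)` (the SAME `q` as in the one-station case), and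
the companion's `quadraticU_nonneg_on_box` words a box from FOUR `U`-edge families (`P(U_e,·) ≥ 0`, `P(U_e,·) − qW ≥ 0`, `W = (U_b − U_a)²/4`) plus the corner facts (here: the two
ranges, affine, and the two bracket inequalities `K₁d₂… ` — `K₁ ≤ 2td₁`, `2td₂ ≤ K₂`, bilinear — and `E > 0`, which FOLLOWS from the bracket when one of the two is strict; we ask the strict
right bracket `2td₂ < K₂` at the corners... no: we ask `E > 0` through the bracket facts and `κ₁ < κ₂` in the form `K₁d₂ < K₂d₁` is implied by `K₁ ≤ 2td₁` and `2td₂ < K₂`? only with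
`d₁, d₂ > 0`: `K₁d₂ ≤ 2td₁d₂ < K₂d₁` ✓ — so the corners carry the STRICT right bracket `2t d₂ < K₂`).

* §1 `ObsStiffnessSeqCeilingAt_of_two_apexSources_affineFloors_twoStations_cleared`; §2 `ObsStiffnessSeqCeilingAt_on_box_of_two_apexSources_affineFloors_twoStations`.

The ⅞ use: left = M4′ (station 29/5; own word + t′-chord `K₂` floor / + kinematic ceiling) or the M2∧M3′ σ-chord, right = the `(8, 7/8, 0)` ray station (`κ_R = −8t/(U − 8) ≥ 0`, kinematic
`K₂` floor) — the g4 two-source POINT words of `…_apexRay8_cellsK05x.lean`, now as AREA words on K054–K056.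

References: T. Koma, H. Tasaki, J. Stat. Phys. 76 (1994) 745, §1 [KomaTasaki1994]; D. J. Scalapino, S. R. White, S.-C. Zhang, PRB 47 (1993) 7995, §II [ScalapinoWhiteZhang1993];
T. Hazra, N. Verma, M. Randeria, PRX 9 (2019) 031049, eq. (4) [HazraVermaRanderia2019].
-/

noncomputable section

namespace Summit.Ventures.CertifiedManyBodySolver.Observables

open Literature.MathematicalPhysics.QuantumLattice
open Literature.MathematicalPhysics.QuantumLattice.ThermodynamicLimit
open Literature.MathematicalPhysics.QuantumFieldTheory
open Literature.Probability.LatticeModels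
open Matrix Finset Filter Topology HubbardWave0
open scoped Matrix BigOperators ComplexOrder

/-! ## §1 The cleared point master: two affine-floor members at two stations -/

section Cleared

variable {t U n U₁ U₂ sa sb : ℝ}

/-- **TWO APEX SOURCES AT TWO STATIONS, CLEARED.** Stations `0 ≤ U₁ < U`, `0 ≤ U₂ < U`, density `0 ≤ n < 2`; member `a` = the class `(s_a, U₁, n)` with an affine hopping floor
`α_a + β_aκ` on `[κlo_a, κhi_a]`, member `b` = the class `(s_b, U₂, n)` with `α_b + β_bκ` on `[κlo_b, κhi_b]`. With `d₁ = U − U₁`, `d₂ = U − U₂`, `K_a = Us_a − U₁t`, `K_b = Us_b − U₂t`: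
ranges `κlo_a d₁ ≤ K_a ≤ κhi_a d₁`, `κlo_b d₂ ≤ K_b ≤ κhi_b d₂`; bracket `K_a ≤ 2td₁` and STRICT `2td₂ < K_b`; and
`0 ≤ 4c(K_b d₁ − K_a d₂) + (K_b − 2td₂)(α_a d₁ + β_a K_a) + (2td₁ − K_a)(α_b d₂ + β_b K_b)` ⇒ `ObsStiffnessSeqCeilingAt t U n c`.
[cite: KomaTasaki1994, §1] [cite: ScalapinoWhiteZhang1993, §II] [cite: HazraVermaRanderia2019, eq. (4)] -/
theorem ObsStiffnessSeqCeilingAt_of_two_apexSources_affineFloors_twoStations_cleared (hU₁0 : 0 ≤ U₁) (hU₁ : U₁ < U)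
    (hU₂0 : 0 ≤ U₂) (hU₂ : U₂ < U) (hn0 : 0 ≤ n) (hn2 : n < 2) {αa βa κloa κhia αb βb κlob κhib : ℝ}
    (ha : ∀ κ : ℝ, κloa ≤ κ → κ ≤ κhia →
      ∀ (ω : InfVolFermionState 2) (Ls : ℕ → ℕ) (ψ : ∀ L, Fock (Orb (FermionTorus 2 L))),
      Tendsto Ls atTop atTop →
      (∀ j, IsGroundStateInSector (hubbardTorusTT' (Ls j) 1 sa U₁) (rectN n (Ls j)) 0 (ψ (Ls j))) →
      (∀ j, star (ψ (Ls j)) ⬝ᵥ ψ (Ls j) = 1) → ω.IsTorusLimitOf ψ Ls →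
      αa + βa * κ ≤ ω.meanEnergy (hubbardTTPrimeFermionInteraction 1 κ 0) 1)
    (hb : ∀ κ : ℝ, κlob ≤ κ → κ ≤ κhib →
      ∀ (ω : InfVolFermionState 2) (Ls : ℕ → ℕ) (ψ : ∀ L, Fock (Orb (FermionTorus 2 L))),
      Tendsto Ls atTop atTop →
      (∀ j, IsGroundStateInSector (hubbardTorusTT' (Ls j) 1 sb U₂) (rectN n (Ls j)) 0 (ψ (Ls j))) →
      (∀ j, star (ψ (Ls j)) ⬝ᵥ ψ (Ls j) = 1) → ω.IsTorusLimitOf ψ Ls →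
      αb + βb * κ ≤ ω.meanEnergy (hubbardTTPrimeFermionInteraction 1 κ 0) 1)
    (hloa : κloa * (U - U₁) ≤ U * sa - U₁ * t) (hhia : U * sa - U₁ * t ≤ κhia * (U - U₁))
    (hlob : κlob * (U - U₂) ≤ U * sb - U₂ * t) (hhib : U * sb - U₂ * t ≤ κhib * (U - U₂))
    (hbra : U * sa - U₁ * t ≤ 2 * t * (U - U₁)) (hbrb : 2 * t * (U - U₂) < U * sb - U₂ * t) (c : ℚ)
    (hc : 0 ≤ 4 * ((c : ℚ) : ℝ) * ((U * sb - U₂ * t) * (U - U₁) - (U * sa - U₁ * t) * (U - U₂)) +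
      ((U * sb - U₂ * t) - 2 * t * (U - U₂)) * (αa * (U - U₁) + βa * (U * sa - U₁ * t)) +
      (2 * t * (U - U₁) - (U * sa - U₁ * t)) * (αb * (U - U₂) + βb * (U * sb - U₂ * t))) :
    ObsStiffnessSeqCeilingAt t U n c := by
  have hd₁ : 0 < U - U₁ := sub_pos.2 hU₁
  have hd₂ : 0 < U - U₂ := sub_pos.2 hU₂
  have hE : 0 < (U * sb - U₂ * t) * (U - U₁) - (U * sa - U₁ * t) * (U - U₂) := by nlinarith
  have hκa : (U * sa - U₁ * t) / (U - U₁) * (U - U₁) = U * sa - U₁ * t := div_mul_cancel₀ _ hd₁.ne'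
  have hκb : (U * sb - U₂ * t) / (U - U₂) * (U - U₂) = U * sb - U₂ * t := div_mul_cancel₀ _ hd₂.ne'
  refine ObsStiffnessSeqCeilingAt_of_two_apexSources_weighted (s₁ := sa) (U₁ := U₁) (s₂ := sb) (U₂ := U₂) (t'P := t) (UP := U)
    (n := n) hU₁0 hU₁ hU₂0 hU₂ hn0 hn2
    (μ₁ := ((U * sb - U₂ * t) - 2 * t * (U - U₂)) * (U - U₁) / ((U * sb - U₂ * t) * (U - U₁) - (U * sa - U₁ * t) * (U - U₂)))
    (μ₂ := (2 * t * (U - U₁) - (U * sa - U₁ * t)) * (U - U₂) / ((U * sb - U₂ * t) * (U - U₁) - (U * sa - U₁ * t) * (U - U₂)))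
    (div_nonneg (mul_nonneg (by linarith) hd₁.le) hE.le) (div_nonneg (mul_nonneg (by linarith) hd₂.le) hE.le) ?_ ?_
    (ha _ (by rw [le_div_iff₀ hd₁]; exact hloa) (by rw [div_le_iff₀ hd₁]; exact hhia))
    (hb _ (by rw [le_div_iff₀ hd₂]; exact hlob) (by rw [div_le_iff₀ hd₂]; exact hhib)) c ?_
  · rw [← add_div, div_eq_one_iff_eq hE.ne']; ring
  · rw [div_mul_eq_mul_div, div_mul_eq_mul_div, ← add_div, div_eq_iff hE.ne']
    have e1 : ((U * sb - U₂ * t) - 2 * t * (U - U₂)) * (U - U₁) * ((U * sa - U₁ * t) / (U - U₁)) =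
        ((U * sb - U₂ * t) - 2 * t * (U - U₂)) * (U * sa - U₁ * t) := by
      rw [mul_assoc, mul_comm (U - U₁), hκa]
    have e2 : (2 * t * (U - U₁) - (U * sa - U₁ * t)) * (U - U₂) * ((U * sb - U₂ * t) / (U - U₂)) =
        (2 * t * (U - U₁) - (U * sa - U₁ * t)) * (U * sb - U₂ * t) := by
      rw [mul_assoc, mul_comm (U - U₂), hκb]
    rw [e1, e2]; ring
  · have ea : αa + βa * ((U * sa - U₁ * t) / (U - U₁)) = (αa * (U - U₁) + βa * (U * sa - U₁ * t)) / (U - U₁) := by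
      rw [eq_div_iff hd₁.ne', add_mul, mul_assoc, hκa]
    have eb : αb + βb * ((U * sb - U₂ * t) / (U - U₂)) = (αb * (U - U₂) + βb * (U * sb - U₂ * t)) / (U - U₂) := by
      rw [eq_div_iff hd₂.ne', add_mul, mul_assoc, hκb]
    rw [ea, eb]
    have f1 : ((U * sb - U₂ * t) - 2 * t * (U - U₂)) * (U - U₁) / ((U * sb - U₂ * t) * (U - U₁) - (U * sa - U₁ * t) * (U - U₂)) *
        ((αa * (U - U₁) + βa * (U * sa - U₁ * t)) / (U - U₁)) =
        ((U * sb - U₂ * t) - 2 * t * (U - U₂)) * (αa * (U - U₁) + βa * (U * sa - U₁ * t)) /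
          ((U * sb - U₂ * t) * (U - U₁) - (U * sa - U₁ * t) * (U - U₂)) := by
      rw [div_mul_div_comm, mul_assoc, mul_comm (U - U₁) (αa * (U - U₁) + βa * (U * sa - U₁ * t)), ← mul_assoc,
        mul_div_mul_right _ _ hd₁.ne']
    have f2 : (2 * t * (U - U₁) - (U * sa - U₁ * t)) * (U - U₂) / ((U * sb - U₂ * t) * (U - U₁) - (U * sa - U₁ * t) * (U - U₂)) *
        ((αb * (U - U₂) + βb * (U * sb - U₂ * t)) / (U - U₂)) =
        (2 * t * (U - U₁) - (U * sa - U₁ * t)) * (αb * (U - U₂) + βb * (U * sb - U₂ * t)) /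
          ((U * sb - U₂ * t) * (U - U₁) - (U * sa - U₁ * t) * (U - U₂)) := by
      rw [div_mul_div_comm, mul_assoc, mul_comm (U - U₂) (αb * (U - U₂) + βb * (U * sb - U₂ * t)), ← mul_assoc,
        mul_div_mul_right _ _ hd₂.ne']
    rw [f1, f2, ← add_div]
    have hN : -(4 * ((c : ℚ) : ℝ)) * ((U * sb - U₂ * t) * (U - U₁) - (U * sa - U₁ * t) * (U - U₂)) ≤
        ((U * sb - U₂ * t) - 2 * t * (U - U₂)) * (αa * (U - U₁) + βa * (U * sa - U₁ * t)) +
          (2 * t * (U - U₁) - (U * sa - U₁ * t)) * (αb * (U - U₂) + βb * (U * sb - U₂ * t)) := by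
      nlinarith [hc]
    have hNE := (le_div_iff₀ hE).2 hN
    linarith

end Cleared

/-! ## §2 THE TWO-STATION BOX THEOREM: four `U`-edge families + corner facts word the whole box -/

section Box

variable {n U₁ U₂ sa sb : ℝ}

/-- **TWO-STATION BOX WORD.** Stations `0 ≤ U₁`, `0 ≤ U₂`, members with affine hopping floors on hopping ranges (§1); a box `max(U₁,U₂) < U_a < U_b`, `t₁ < t₂`; at the four corners:
both apex hoppings in range, `K_a ≤ 2td₁`, and STRICT `2td₂ < K_b` (affine/bilinear facts); on the two `U`-edges, for every `t ∈ [t₁,t₂]`: `0 ≤ P(U_e,t)` and `0 ≤ P(U_e,t) − q(t)·(U_b − U_a)²/4`,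
`P` the cleared word of §1 (a quadratic in `U` with leading coefficient `q(t) = 4c(s_b − s_a) + (s_b − 2t)(α_a + β_a s_a) + (2t − s_a)(α_b + β_b s_b)`). Then `ObsStiffnessSeqCeilingAt t U n c` at EVERY
point of the box (companion `quadraticU_nonneg_on_box`, then §1). [cite: KomaTasaki1994, §1] [cite: ScalapinoWhiteZhang1993, §II] [cite: HazraVermaRanderia2019, eq. (4)] -/
theorem ObsStiffnessSeqCeilingAt_on_box_of_two_apexSources_affineFloors_twoStations (hU₁0 : 0 ≤ U₁) (hU₂0 : 0 ≤ U₂)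
    (hn0 : 0 ≤ n) (hn2 : n < 2) {αa βa κloa κhia αb βb κlob κhib : ℝ}
    (ha : ∀ κ : ℝ, κloa ≤ κ → κ ≤ κhia →
      ∀ (ω : InfVolFermionState 2) (Ls : ℕ → ℕ) (ψ : ∀ L, Fock (Orb (FermionTorus 2 L))),
      Tendsto Ls atTop atTop →
      (∀ j, IsGroundStateInSector (hubbardTorusTT' (Ls j) 1 sa U₁) (rectN n (Ls j)) 0 (ψ (Ls j))) →
      (∀ j, star (ψ (Ls j)) ⬝ᵥ ψ (Ls j) = 1) → ω.IsTorusLimitOf ψ Ls →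
      αa + βa * κ ≤ ω.meanEnergy (hubbardTTPrimeFermionInteraction 1 κ 0) 1)
    (hb : ∀ κ : ℝ, κlob ≤ κ → κ ≤ κhib →
      ∀ (ω : InfVolFermionState 2) (Ls : ℕ → ℕ) (ψ : ∀ L, Fock (Orb (FermionTorus 2 L))),
      Tendsto Ls atTop atTop →
      (∀ j, IsGroundStateInSector (hubbardTorusTT' (Ls j) 1 sb U₂) (rectN n (Ls j)) 0 (ψ (Ls j))) →
      (∀ j, star (ψ (Ls j)) ⬝ᵥ ψ (Ls j) = 1) → ω.IsTorusLimitOf ψ Ls →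
      αb + βb * κ ≤ ω.meanEnergy (hubbardTTPrimeFermionInteraction 1 κ 0) 1)
    {Ua Ub t₁ t₂ : ℝ} (hUa₁ : U₁ < Ua) (hUa₂ : U₂ < Ua) (hab : Ua < Ub) (h12 : t₁ < t₂)
    (hloa₁ : κloa * (Ua - U₁) ≤ Ua * sa - U₁ * t₁) (hloa₂ : κloa * (Ua - U₁) ≤ Ua * sa - U₁ * t₂)
    (hloa₃ : κloa * (Ub - U₁) ≤ Ub * sa - U₁ * t₁) (hloa₄ : κloa * (Ub - U₁) ≤ Ub * sa - U₁ * t₂)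
    (hhia₁ : Ua * sa - U₁ * t₁ ≤ κhia * (Ua - U₁)) (hhia₂ : Ua * sa - U₁ * t₂ ≤ κhia * (Ua - U₁))
    (hhia₃ : Ub * sa - U₁ * t₁ ≤ κhia * (Ub - U₁)) (hhia₄ : Ub * sa - U₁ * t₂ ≤ κhia * (Ub - U₁))
    (hlob₁ : κlob * (Ua - U₂) ≤ Ua * sb - U₂ * t₁) (hlob₂ : κlob * (Ua - U₂) ≤ Ua * sb - U₂ * t₂)
    (hlob₃ : κlob * (Ub - U₂) ≤ Ub * sb - U₂ * t₁) (hlob₄ : κlob * (Ub - U₂) ≤ Ub * sb - U₂ * t₂)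
    (hhib₁ : Ua * sb - U₂ * t₁ ≤ κhib * (Ua - U₂)) (hhib₂ : Ua * sb - U₂ * t₂ ≤ κhib * (Ua - U₂))
    (hhib₃ : Ub * sb - U₂ * t₁ ≤ κhib * (Ub - U₂)) (hhib₄ : Ub * sb - U₂ * t₂ ≤ κhib * (Ub - U₂))
    (hbra₁ : Ua * sa - U₁ * t₁ ≤ 2 * t₁ * (Ua - U₁)) (hbra₂ : Ua * sa - U₁ * t₂ ≤ 2 * t₂ * (Ua - U₁))
    (hbra₃ : Ub * sa - U₁ * t₁ ≤ 2 * t₁ * (Ub - U₁)) (hbra₄ : Ub * sa - U₁ * t₂ ≤ 2 * t₂ * (Ub - U₁))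
    (hbrb₁ : 2 * t₁ * (Ua - U₂) < Ua * sb - U₂ * t₁) (hbrb₂ : 2 * t₂ * (Ua - U₂) < Ua * sb - U₂ * t₂)
    (hbrb₃ : 2 * t₁ * (Ub - U₂) < Ub * sb - U₂ * t₁) (hbrb₄ : 2 * t₂ * (Ub - U₂) < Ub * sb - U₂ * t₂) (c : ℚ)
    (hPa : ∀ t ∈ Set.Icc t₁ t₂, 0 ≤ 4 * ((c : ℚ) : ℝ) * ((Ua * sb - U₂ * t) * (Ua - U₁) - (Ua * sa - U₁ * t) * (Ua - U₂)) +
      ((Ua * sb - U₂ * t) - 2 * t * (Ua - U₂)) * (αa * (Ua - U₁) + βa * (Ua * sa - U₁ * t)) +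
      (2 * t * (Ua - U₁) - (Ua * sa - U₁ * t)) * (αb * (Ua - U₂) + βb * (Ua * sb - U₂ * t)))
    (hPb : ∀ t ∈ Set.Icc t₁ t₂, 0 ≤ 4 * ((c : ℚ) : ℝ) * ((Ub * sb - U₂ * t) * (Ub - U₁) - (Ub * sa - U₁ * t) * (Ub - U₂)) +
      ((Ub * sb - U₂ * t) - 2 * t * (Ub - U₂)) * (αa * (Ub - U₁) + βa * (Ub * sa - U₁ * t)) +
      (2 * t * (Ub - U₁) - (Ub * sa - U₁ * t)) * (αb * (Ub - U₂) + βb * (Ub * sb - U₂ * t)))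
    (hPaW : ∀ t ∈ Set.Icc t₁ t₂, 0 ≤ 4 * ((c : ℚ) : ℝ) * ((Ua * sb - U₂ * t) * (Ua - U₁) - (Ua * sa - U₁ * t) * (Ua - U₂)) +
      ((Ua * sb - U₂ * t) - 2 * t * (Ua - U₂)) * (αa * (Ua - U₁) + βa * (Ua * sa - U₁ * t)) +
      (2 * t * (Ua - U₁) - (Ua * sa - U₁ * t)) * (αb * (Ua - U₂) + βb * (Ua * sb - U₂ * t)) -
      (4 * ((c : ℚ) : ℝ) * (sb - sa) + (sb - 2 * t) * (αa + βa * sa) + (2 * t - sa) * (αb + βb * sb)) * ((Ub - Ua) ^ 2 / 4))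
    (hPbW : ∀ t ∈ Set.Icc t₁ t₂, 0 ≤ 4 * ((c : ℚ) : ℝ) * ((Ub * sb - U₂ * t) * (Ub - U₁) - (Ub * sa - U₁ * t) * (Ub - U₂)) +
      ((Ub * sb - U₂ * t) - 2 * t * (Ub - U₂)) * (αa * (Ub - U₁) + βa * (Ub * sa - U₁ * t)) +
      (2 * t * (Ub - U₁) - (Ub * sa - U₁ * t)) * (αb * (Ub - U₂) + βb * (Ub * sb - U₂ * t)) -
      (4 * ((c : ℚ) : ℝ) * (sb - sa) + (sb - 2 * t) * (αa + βa * sa) + (2 * t - sa) * (αb + βb * sb)) * ((Ub - Ua) ^ 2 / 4)) :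
    ∀ U ∈ Set.Icc Ua Ub, ∀ t ∈ Set.Icc t₁ t₂, ObsStiffnessSeqCeilingAt t U n c := by
  intro U hU t ht
  have hU₁lt : U₁ < U := hUa₁.trans_le hU.1
  have hU₂lt : U₂ < U := hUa₂.trans_le hU.1
  have hloa : κloa * (U - U₁) ≤ U * sa - U₁ * t := by
    have h := bilinear_nonneg_on_box (a := κloa * U₁) (b := sa - κloa) (c := -U₁) (d := 0) hab h12 hU ht
      (by linarith only [hloa₁]) (by linarith only [hloa₂]) (by linarith only [hloa₃]) (by linarith only [hloa₄])
    linarith only [h]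
  have hhia : U * sa - U₁ * t ≤ κhia * (U - U₁) := by
    have h := bilinear_nonneg_on_box (a := -(κhia * U₁)) (b := κhia - sa) (c := U₁) (d := 0) hab h12 hU ht
      (by linarith only [hhia₁]) (by linarith only [hhia₂]) (by linarith only [hhia₃]) (by linarith only [hhia₄])
    linarith only [h]
  have hlob : κlob * (U - U₂) ≤ U * sb - U₂ * t := by
    have h := bilinear_nonneg_on_box (a := κlob * U₂) (b := sb - κlob) (c := -U₂) (d := 0) hab h12 hU ht
      (by linarith only [hlob₁]) (by linarith only [hlob₂]) (by linarith only [hlob₃]) (by linarith only [hlob₄])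
    linarith only [h]
  have hhib : U * sb - U₂ * t ≤ κhib * (U - U₂) := by
    have h := bilinear_nonneg_on_box (a := -(κhib * U₂)) (b := κhib - sb) (c := U₂) (d := 0) hab h12 hU ht
      (by linarith only [hhib₁]) (by linarith only [hhib₂]) (by linarith only [hhib₃]) (by linarith only [hhib₄])
    linarith only [h]
  have hbra : U * sa - U₁ * t ≤ 2 * t * (U - U₁) := by
    have h := bilinear_nonneg_on_box (a := 0) (b := -sa) (c := -U₁) (d := 2) hab h12 hU ht
      (by linarith only [hbra₁]) (by linarith only [hbra₂]) (by linarith only [hbra₃]) (by linarith only [hbra₄])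
    linarith only [h]
  -- the strict right bracket: interpolate `K_b − 2td₂ − m ≥ 0` with `m` = the smallest (positive) corner margin
  have hbrb : 2 * t * (U - U₂) < U * sb - U₂ * t := by
    set m := min (min ((Ua * sb - U₂ * t₁) - 2 * t₁ * (Ua - U₂)) ((Ua * sb - U₂ * t₂) - 2 * t₂ * (Ua - U₂)))
        (min ((Ub * sb - U₂ * t₁) - 2 * t₁ * (Ub - U₂)) ((Ub * sb - U₂ * t₂) - 2 * t₂ * (Ub - U₂))) with hm_def
    have hm : 0 < m :=
      lt_min (lt_min (by linarith only [hbrb₁]) (by linarith only [hbrb₂])) (lt_min (by linarith only [hbrb₃]) (by linarith only [hbrb₄]))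
    have h1 : m ≤ (Ua * sb - U₂ * t₁) - 2 * t₁ * (Ua - U₂) := (min_le_left _ _).trans (min_le_left _ _)
    have h2 : m ≤ (Ua * sb - U₂ * t₂) - 2 * t₂ * (Ua - U₂) := (min_le_left _ _).trans (min_le_right _ _)
    have h3 : m ≤ (Ub * sb - U₂ * t₁) - 2 * t₁ * (Ub - U₂) := (min_le_right _ _).trans (min_le_left _ _)
    have h4 : m ≤ (Ub * sb - U₂ * t₂) - 2 * t₂ * (Ub - U₂) := (min_le_right _ _).trans (min_le_right _ _)
    have h := bilinear_nonneg_on_box (a := -m) (b := sb) (c := U₂) (d := -2) hab h12 hU ht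
      (by linarith only [h1]) (by linarith only [h2]) (by linarith only [h3]) (by linarith only [h4])
    linarith only [h, hm]
  refine ObsStiffnessSeqCeilingAt_of_two_apexSources_affineFloors_twoStations_cleared hU₁0 hU₁lt hU₂0 hU₂lt hn0 hn2 ha hb
    hloa hhia hlob hhib hbra hbrb c ?_
  have h := quadraticU_nonneg_on_box (U := U)
    (q := 4 * ((c : ℚ) : ℝ) * (sb - sa) + (sb - 2 * t) * (αa + βa * sa) + (2 * t - sa) * (αb + βb * sb))
    (p := 4 * ((c : ℚ) : ℝ) * (-(U₂ * t) - sb * U₁ + U₁ * t + sa * U₂) + (sb - 2 * t) * (-(αa * U₁) - βa * U₁ * t) +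
      (-(U₂ * t) + 2 * t * U₂) * (αa + βa * sa) + (2 * t - sa) * (-(αb * U₂) - βb * U₂ * t) + (-(2 * t * U₁) + U₁ * t) * (αb + βb * sb))
    (r := 4 * ((c : ℚ) : ℝ) * (U₂ * t * U₁ - U₁ * t * U₂) + (-(U₂ * t) + 2 * t * U₂) * (-(αa * U₁) - βa * U₁ * t) +
      (-(2 * t * U₁) + U₁ * t) * (-(αb * U₂) - βb * U₂ * t))
    hab hU (by convert hPa t ht using 1; ring) (by convert hPb t ht using 1; ring)
    (by convert hPaW t ht using 1; ring) (by convert hPbW t ht using 1; ring)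
  convert h using 1
  ring

end Box

end Summit.Ventures.CertifiedManyBodySolver.Observables

end
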